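import Summits.CriticalPhenomena.PercolationContinuityZ3.Theorems.Transplant.FKConnectivityAllQHubCov
import HarnessLib

/-!
# Connectivity correlation inequalities for `φ_{w,q}`, every `q > 0` — the hub covariance bound, file 4: the POLARISED bound between
# `G ∖ g` and `G / g` and the reduction `POL ⇒ HubCovBound` (induction on undecided pairs)

Support file (`--supports stmt-CriticalPhenomena-4575`), FK sub-lane `prim-bschramm-fk-3` (gen 7) of the post-continuity
programme; builds on p205010 (kernel theorem, internal audit signed; external expert review pending).  One definition (the polarised
statement), no named facts, no sorries; standard axioms.

THE REDUCTION (bschramm/FK-BARRIER.md §11.6).  The pattern masses are affine in the parameter of ANY pair `g`: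
`M_w = (1 − p)·M_{w[g↦0]} + p·M_{w[g↦1]}` (`p = w g`; `w[g↦1]` plays the role of `G/g`, `w[g↦0]` of `G∖g`), and the three-point
expression `TP` is a quadratic form, so EXACTLY
`TP_w = (1 − p)²·TP_{w[g↦0]} + p²·TP_{w[g↦1]} + 2p(1 − p)·B(M_{w[g↦0]}, M_{w[g↦1]})`
with `B` the symmetric bilinear form of `TP` (`threePoint_affine_expand`).  Hence the POLARISED HUB COVARIANCE BOUND
`PolHubCovUnder μ ν q x y z`: `(1 − q)·[μ(N)ν(C) + ν(N)μ(C) − μ(xy|z)ν(xz|y) − ν(xy|z)μ(xz|y)] ≤ μ(x≁y↔z) + ν(x≁y↔z)`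
(`N = {x≁y, x≁z}`, `C = {x↔y↔z}`; `μ = ν` a probability measure gives twice `HubCovBoundUnder`) for every pair `(φ_{w[g↦0]}, φ_{w[g↦1]})`
implies the hub covariance bound for EVERY weight vector, by induction on the number of pairs with parameter in `(0,1)` (base: all pairs
decided — the measure is a point mass and the covariance vanishes): `hubCovBoundUnder_of_pol`.  NUMERICAL STATUS of the hypothesis
(gen 7): `B(M_{G∖g}, M_{G/g}) ≥ 0` in 12,000 random weighted graphs (`n ≤ 7`, `g` at the hub, away from it, among `{x,y,z}`), 0 negatives;
it is implied by gen 6's coefficientwise positivity and implies `HubCovBoundFKLtOne`; none of the three is proved.  Nothing is asserted here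
beyond the implication.
[cite: Grimmett2006, Thm. (3.1)(a) (p. 37); §1.4 eq. (1.20) (p. 15); §3.9 eq. (3.94) (p. 63)] [cite: Wagner2006, Conj. 5.3 (p. 13)]
-/

noncomputable section

namespace Summit.CriticalPhenomena.PercolationContinuityZ3.Theorems

namespace FK

open MeasureTheory Set Literature.Probability.LatticeModels Literature.Probability.Percolation
open Literature.Probability.Percolation.DecisionTree (ind ind_of_mem ind_of_not_mem ind_nonneg)
open scoped Classical symmDiff

variable {V : Type*} [Fintype V]

/-! ### The polarised statement -/

/-- **Polarised hub covariance bound** between two finite measures `μ, ν` at the hub `x` and the pair `y, z` (probability-normalised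
form; symmetric in `μ, ν`; `μ = ν` a probability measure gives twice `HubCovBoundUnder μ q x y z`):
`(1 − q)·[μ(x≁y,x≁z)ν(x↔y,x↔z) + ν(x≁y,x≁z)μ(x↔y,x↔z) − μ(xy|z)ν(xz|y) − ν(xy|z)μ(xz|y)] ≤ μ(x≁y, y↔z) + ν(x≁y, y↔z)`.
The case of interest is `(μ, ν) = (φ_{w[g↦0]}, φ_{w[g↦1]})` = (delete `g`, contract `g`). [cite: Grimmett2006, §3.9 eq. (3.94) (p. 63)] -/
def PolHubCovUnder (μ ν : Measure (BondConfig V)) (q : ℝ) (x y z : V) : Prop :=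
  (1 - q) *
      (μ.real ((openConn x y : Set (BondConfig V))ᶜ ∩ (openConn x z : Set (BondConfig V))ᶜ) * ν.real (openConn x y ∩ openConn x z) +
        ν.real ((openConn x y : Set (BondConfig V))ᶜ ∩ (openConn x z : Set (BondConfig V))ᶜ) * μ.real (openConn x y ∩ openConn x z) -
        μ.real (openConn x y ∩ (openConn x z : Set (BondConfig V))ᶜ) * ν.real ((openConn x y : Set (BondConfig V))ᶜ ∩ openConn x z) -
        ν.real (openConn x y ∩ (openConn x z : Set (BondConfig V))ᶜ) * μ.real ((openConn x y : Set (BondConfig V))ᶜ ∩ openConn x z)) ≤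
    μ.real ((openConn x y : Set (BondConfig V))ᶜ ∩ openConn y z) + ν.real ((openConn x y : Set (BondConfig V))ᶜ ∩ openConn y z)

/-- For a probability measure the diagonal `μ = ν` of the polarised bound is (twice) the hub covariance bound. [folklore] -/
theorem polHubCovUnder_self_iff (μ : Measure (BondConfig V)) [IsProbabilityMeasure μ] (q : ℝ) (x y z : V) :
    PolHubCovUnder μ μ q x y z ↔ HubCovBoundUnder μ q x y z := by
  unfold PolHubCovUnder HubCovBoundUnder
  rw [probReal_univ, mul_one, mul_one]
  have h1 := measureReal_inter_add_sdiff (μ := μ) (s := (openConn x y : Set (BondConfig V))ᶜ) (measurableSet_openConn_holds x z)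
  have h2 := measureReal_inter_add_sdiff (μ := μ) (s := (openConn x y : Set (BondConfig V))) (measurableSet_openConn_holds x z)
  have h3 := measureReal_inter_add_sdiff (μ := μ) (s := (openConn x z : Set (BondConfig V))) (measurableSet_openConn_holds x y)
  rw [probReal_compl_eq_one_sub (measurableSet_openConn_holds x y)] at h1
  rw [Set.sdiff_eq] at h1 h2 h3
  rw [Set.inter_comm (openConn x z) (openConn x y), Set.inter_comm (openConn x z) (openConn x y : Set (BondConfig V))ᶜ] at h3
  have hN : μ.real ((openConn x y : Set (BondConfig V))ᶜ ∩ (openConn x z : Set (BondConfig V))ᶜ) =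
      1 - μ.real (openConn x y) - μ.real (openConn x z) + μ.real (openConn x y ∩ openConn x z) := by linarith
  have hBxy : μ.real (openConn x y ∩ (openConn x z : Set (BondConfig V))ᶜ) =
      μ.real (openConn x y) - μ.real (openConn x y ∩ openConn x z) := by linarith
  have hBxz : μ.real ((openConn x y : Set (BondConfig V))ᶜ ∩ openConn x z) =
      μ.real (openConn x z) - μ.real (openConn x y ∩ openConn x z) := by linarith
  rw [hN, hBxy, hBxz]
  constructor <;> intro h <;> nlinarith [h]

/-! ### Mass forms -/

/-- The hub covariance bound for `φ_U` in the `N`-form: `0 ≤ Byz·Z − (1−q)(N·C − Bxy·Bxz)` with `N = S(x≁y, x≁z)`.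
[cite: Grimmett2006, §1.4 eq. (1.20) (p. 15); §3.9 (p. 63)] -/
theorem hubCovBoundUnder_iff_threePointN {q : ℝ} (hq0 : 0 < q) (U : Sym2 V → unitInterval) (x y z : V) :
    HubCovBoundUnder (rcMeasureW U q ∅) q x y z ↔
      0 ≤ (∑ ω : BondConfig V, rcWeightW U q ∅ ω * ind ((openConn x y : Set (BondConfig V))ᶜ ∩ openConn y z) ω) *
            rcPartitionFunctionW U q ∅ -
          (1 - q) *
            ((∑ ω : BondConfig V, rcWeightW U q ∅ ω *
                ind ((openConn x y : Set (BondConfig V))ᶜ ∩ (openConn x z : Set (BondConfig V))ᶜ) ω) *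
              (∑ ω : BondConfig V, rcWeightW U q ∅ ω * ind (openConn x y ∩ openConn x z) ω) -
             (∑ ω : BondConfig V, rcWeightW U q ∅ ω * ind (openConn x y ∩ (openConn x z : Set (BondConfig V))ᶜ) ω) *
              (∑ ω : BondConfig V, rcWeightW U q ∅ ω * ind ((openConn x y : Set (BondConfig V))ᶜ ∩ openConn x z) ω)) := by
  rw [hubCovBoundUnder_iff_threePoint hq0, mass_sees_neither_split U q x y z]
  constructor <;> intro h <;> nlinarith [h]

/-- **Measure form ⟺ mass form for the polarised bound** between `φ_{U₀}` and `φ_{U₁}` (`0 < q`):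
`0 ≤ Byz₀Z₁ + Byz₁Z₀ − (1−q)(N₀C₁ + N₁C₀ − Bxy₀Bxz₁ − Bxy₁Bxz₀)`. [cite: Grimmett2006, §1.4 eq. (1.20) (p. 15)] -/
theorem polHubCovUnder_iff_masses {q : ℝ} (hq0 : 0 < q) (U₀ U₁ : Sym2 V → unitInterval) (x y z : V) :
    PolHubCovUnder (rcMeasureW U₀ q ∅) (rcMeasureW U₁ q ∅) q x y z ↔
      0 ≤ (∑ ω : BondConfig V, rcWeightW U₀ q ∅ ω * ind ((openConn x y : Set (BondConfig V))ᶜ ∩ openConn y z) ω) *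
              rcPartitionFunctionW U₁ q ∅ +
            (∑ ω : BondConfig V, rcWeightW U₁ q ∅ ω * ind ((openConn x y : Set (BondConfig V))ᶜ ∩ openConn y z) ω) *
              rcPartitionFunctionW U₀ q ∅ -
          (1 - q) *
            ((∑ ω : BondConfig V, rcWeightW U₀ q ∅ ω *
                  ind ((openConn x y : Set (BondConfig V))ᶜ ∩ (openConn x z : Set (BondConfig V))ᶜ) ω) *
                (∑ ω : BondConfig V, rcWeightW U₁ q ∅ ω * ind (openConn x y ∩ openConn x z) ω) +
              (∑ ω : BondConfig V, rcWeightW U₁ q ∅ ω *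
                  ind ((openConn x y : Set (BondConfig V))ᶜ ∩ (openConn x z : Set (BondConfig V))ᶜ) ω) *
                (∑ ω : BondConfig V, rcWeightW U₀ q ∅ ω * ind (openConn x y ∩ openConn x z) ω) -
              (∑ ω : BondConfig V, rcWeightW U₀ q ∅ ω * ind (openConn x y ∩ (openConn x z : Set (BondConfig V))ᶜ) ω) *
                (∑ ω : BondConfig V, rcWeightW U₁ q ∅ ω * ind ((openConn x y : Set (BondConfig V))ᶜ ∩ openConn x z) ω) -
              (∑ ω : BondConfig V, rcWeightW U₁ q ∅ ω * ind (openConn x y ∩ (openConn x z : Set (BondConfig V))ᶜ) ω) *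
                (∑ ω : BondConfig V, rcWeightW U₀ q ∅ ω * ind ((openConn x y : Set (BondConfig V))ᶜ ∩ openConn x z) ω)) := by
  set N0 := ∑ ω : BondConfig V, rcWeightW U₀ q ∅ ω * ind ((openConn x y : Set (BondConfig V))ᶜ ∩ (openConn x z : Set (BondConfig V))ᶜ) ω
  set N1 := ∑ ω : BondConfig V, rcWeightW U₁ q ∅ ω * ind ((openConn x y : Set (BondConfig V))ᶜ ∩ (openConn x z : Set (BondConfig V))ᶜ) ω
  set C0 := ∑ ω : BondConfig V, rcWeightW U₀ q ∅ ω * ind (openConn x y ∩ openConn x z) ω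
  set C1 := ∑ ω : BondConfig V, rcWeightW U₁ q ∅ ω * ind (openConn x y ∩ openConn x z) ω
  set P0 := ∑ ω : BondConfig V, rcWeightW U₀ q ∅ ω * ind (openConn x y ∩ (openConn x z : Set (BondConfig V))ᶜ) ω
  set P1 := ∑ ω : BondConfig V, rcWeightW U₁ q ∅ ω * ind (openConn x y ∩ (openConn x z : Set (BondConfig V))ᶜ) ω
  set R0 := ∑ ω : BondConfig V, rcWeightW U₀ q ∅ ω * ind ((openConn x y : Set (BondConfig V))ᶜ ∩ openConn x z) ω
  set R1 := ∑ ω : BondConfig V, rcWeightW U₁ q ∅ ω * ind ((openConn x y : Set (BondConfig V))ᶜ ∩ openConn x z) ω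
  set Y0 := ∑ ω : BondConfig V, rcWeightW U₀ q ∅ ω * ind ((openConn x y : Set (BondConfig V))ᶜ ∩ openConn y z) ω
  set Y1 := ∑ ω : BondConfig V, rcWeightW U₁ q ∅ ω * ind ((openConn x y : Set (BondConfig V))ᶜ ∩ openConn y z) ω
  set Z0 := rcPartitionFunctionW U₀ q ∅
  set Z1 := rcPartitionFunctionW U₁ q ∅
  have hZ0 : 0 < Z0 := rcPartitionFunctionW_pos U₀ hq0 (∅ : Set V)
  have hZ1 : 0 < Z1 := rcPartitionFunctionW_pos U₁ hq0 (∅ : Set V)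
  unfold PolHubCovUnder
  simp only [rcMeasureW_real_eq_sum_div _ hq0 ∅]
  rw [show (1 - q) * (N0 / Z0 * (C1 / Z1) + N1 / Z1 * (C0 / Z0) - P0 / Z0 * (R1 / Z1) - P1 / Z1 * (R0 / Z0)) =
      ((1 - q) * (N0 * C1 + N1 * C0 - P0 * R1 - P1 * R0)) / (Z0 * Z1) by field_simp]
  rw [show Y0 / Z0 + Y1 / Z1 = (Y0 * Z1 + Y1 * Z0) / (Z0 * Z1) by field_simp, div_le_div_iff_of_pos_right (mul_pos hZ0 hZ1)]
  constructor <;> intro h <;> linarith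

/-- **Affine expansion of the three-point expression in one pair.**  For any pair `g` with parameter `p = w g`, writing `S⁰, S¹` for the
masses under `w[g↦0], w[g↦1]`: `TP_w = (1−p)²·TP⁰ + p²·TP¹ + p(1−p)·[Byz⁰Z¹ + Byz¹Z⁰ − (1−q)(N⁰C¹ + N¹C⁰ − Bxy⁰Bxz¹ − Bxy¹Bxz⁰)]`.
[cite: Grimmett2006, Thm. (3.1)(a) (p. 37); §1.4 eq. (1.20) (p. 15)] -/
theorem threePoint_affine_expand (w : Sym2 V → unitInterval) (q : ℝ) (g : Sym2 V) (x y z : V) :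
    (∑ ω : BondConfig V, rcWeightW w q ∅ ω * ind ((openConn x y : Set (BondConfig V))ᶜ ∩ openConn y z) ω) * rcPartitionFunctionW w q ∅ -
        (1 - q) *
          ((∑ ω : BondConfig V, rcWeightW w q ∅ ω *
              ind ((openConn x y : Set (BondConfig V))ᶜ ∩ (openConn x z : Set (BondConfig V))ᶜ) ω) *
            (∑ ω : BondConfig V, rcWeightW w q ∅ ω * ind (openConn x y ∩ openConn x z) ω) -
           (∑ ω : BondConfig V, rcWeightW w q ∅ ω * ind (openConn x y ∩ (openConn x z : Set (BondConfig V))ᶜ) ω) *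
            (∑ ω : BondConfig V, rcWeightW w q ∅ ω * ind ((openConn x y : Set (BondConfig V))ᶜ ∩ openConn x z) ω)) =
      (1 - (w g : ℝ)) ^ 2 *
          ((∑ ω : BondConfig V, rcWeightW (Function.update w g 0) q ∅ ω * ind ((openConn x y : Set (BondConfig V))ᶜ ∩ openConn y z) ω) *
              rcPartitionFunctionW (Function.update w g 0) q ∅ -
            (1 - q) *
              ((∑ ω : BondConfig V, rcWeightW (Function.update w g 0) q ∅ ω *
                  ind ((openConn x y : Set (BondConfig V))ᶜ ∩ (openConn x z : Set (BondConfig V))ᶜ) ω) *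
                (∑ ω : BondConfig V, rcWeightW (Function.update w g 0) q ∅ ω * ind (openConn x y ∩ openConn x z) ω) -
               (∑ ω : BondConfig V, rcWeightW (Function.update w g 0) q ∅ ω * ind (openConn x y ∩ (openConn x z : Set (BondConfig V))ᶜ) ω) *
                (∑ ω : BondConfig V, rcWeightW (Function.update w g 0) q ∅ ω * ind ((openConn x y : Set (BondConfig V))ᶜ ∩ openConn x z) ω))) +
        (w g : ℝ) ^ 2 *
          ((∑ ω : BondConfig V, rcWeightW (Function.update w g 1) q ∅ ω * ind ((openConn x y : Set (BondConfig V))ᶜ ∩ openConn y z) ω) *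
              rcPartitionFunctionW (Function.update w g 1) q ∅ -
            (1 - q) *
              ((∑ ω : BondConfig V, rcWeightW (Function.update w g 1) q ∅ ω *
                  ind ((openConn x y : Set (BondConfig V))ᶜ ∩ (openConn x z : Set (BondConfig V))ᶜ) ω) *
                (∑ ω : BondConfig V, rcWeightW (Function.update w g 1) q ∅ ω * ind (openConn x y ∩ openConn x z) ω) -
               (∑ ω : BondConfig V, rcWeightW (Function.update w g 1) q ∅ ω * ind (openConn x y ∩ (openConn x z : Set (BondConfig V))ᶜ) ω) *
                (∑ ω : BondConfig V, rcWeightW (Function.update w g 1) q ∅ ω * ind ((openConn x y : Set (BondConfig V))ᶜ ∩ openConn x z) ω))) +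
        (w g : ℝ) * (1 - (w g : ℝ)) *
          ((∑ ω : BondConfig V, rcWeightW (Function.update w g 0) q ∅ ω * ind ((openConn x y : Set (BondConfig V))ᶜ ∩ openConn y z) ω) *
              rcPartitionFunctionW (Function.update w g 1) q ∅ +
            (∑ ω : BondConfig V, rcWeightW (Function.update w g 1) q ∅ ω * ind ((openConn x y : Set (BondConfig V))ᶜ ∩ openConn y z) ω) *
              rcPartitionFunctionW (Function.update w g 0) q ∅ -
          (1 - q) *
            ((∑ ω : BondConfig V, rcWeightW (Function.update w g 0) q ∅ ω *
                  ind ((openConn x y : Set (BondConfig V))ᶜ ∩ (openConn x z : Set (BondConfig V))ᶜ) ω) *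
                (∑ ω : BondConfig V, rcWeightW (Function.update w g 1) q ∅ ω * ind (openConn x y ∩ openConn x z) ω) +
              (∑ ω : BondConfig V, rcWeightW (Function.update w g 1) q ∅ ω *
                  ind ((openConn x y : Set (BondConfig V))ᶜ ∩ (openConn x z : Set (BondConfig V))ᶜ) ω) *
                (∑ ω : BondConfig V, rcWeightW (Function.update w g 0) q ∅ ω * ind (openConn x y ∩ openConn x z) ω) -
              (∑ ω : BondConfig V, rcWeightW (Function.update w g 0) q ∅ ω * ind (openConn x y ∩ (openConn x z : Set (BondConfig V))ᶜ) ω) *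
                (∑ ω : BondConfig V, rcWeightW (Function.update w g 1) q ∅ ω * ind ((openConn x y : Set (BondConfig V))ᶜ ∩ openConn x z) ω) -
              (∑ ω : BondConfig V, rcWeightW (Function.update w g 1) q ∅ ω * ind (openConn x y ∩ (openConn x z : Set (BondConfig V))ᶜ) ω) *
                (∑ ω : BondConfig V, rcWeightW (Function.update w g 0) q ∅ ω * ind ((openConn x y : Set (BondConfig V))ᶜ ∩ openConn x z) ω))) := by
  rw [sum_rcWeightW_ind_affine w q g ((openConn x y : Set (BondConfig V))ᶜ ∩ openConn y z),
    sum_rcWeightW_ind_affine w q g ((openConn x y : Set (BondConfig V))ᶜ ∩ (openConn x z : Set (BondConfig V))ᶜ),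
    sum_rcWeightW_ind_affine w q g (openConn x y ∩ openConn x z),
    sum_rcWeightW_ind_affine w q g (openConn x y ∩ (openConn x z : Set (BondConfig V))ᶜ),
    sum_rcWeightW_ind_affine w q g ((openConn x y : Set (BondConfig V))ᶜ ∩ openConn x z),
    rcPartitionFunctionW_affine w q g]
  ring

/-! ### Base case: all pairs decided -/

/-- **Base case.**  With all pairs decided the three-point expression (in `N`-form) is `Byz·Z ≥ 0`: the products `N·C` and `Bxy·Bxz` of
masses of DISJOINT events vanish for a point mass (fk-2's `sum_rcWeightW_ind_rigid`). [cite: Grimmett2006, §1.4 eq. (1.20) (p. 15)] -/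
theorem threePointN_nonneg_of_decided (w : Sym2 V → unitInterval) {q : ℝ} (hq0 : 0 < q)
    (hdec : ∀ e : Sym2 V, (w e : ℝ) = 0 ∨ (w e : ℝ) = 1) (x y z : V) :
    0 ≤ (∑ ω : BondConfig V, rcWeightW w q ∅ ω * ind ((openConn x y : Set (BondConfig V))ᶜ ∩ openConn y z) ω) *
            rcPartitionFunctionW w q ∅ -
          (1 - q) *
            ((∑ ω : BondConfig V, rcWeightW w q ∅ ω *
                ind ((openConn x y : Set (BondConfig V))ᶜ ∩ (openConn x z : Set (BondConfig V))ᶜ) ω) *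
              (∑ ω : BondConfig V, rcWeightW w q ∅ ω * ind (openConn x y ∩ openConn x z) ω) -
             (∑ ω : BondConfig V, rcWeightW w q ∅ ω * ind (openConn x y ∩ (openConn x z : Set (BondConfig V))ᶜ) ω) *
              (∑ ω : BondConfig V, rcWeightW w q ∅ ω * ind ((openConn x y : Set (BondConfig V))ᶜ ∩ openConn x z) ω)) := by
  simp only [sum_rcWeightW_ind_rigid w q hdec]
  set ωs : BondConfig V := {e | (w e : ℝ) = 1}
  set W := rcWeightW w q ∅ ωs
  have hW : 0 ≤ W := rcWeightW_nonneg w hq0.le ∅ ωs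
  have hZ : 0 ≤ rcPartitionFunctionW w q ∅ := (rcPartitionFunctionW_pos w hq0 ∅).le
  have hNC : ind ((openConn x y : Set (BondConfig V))ᶜ ∩ (openConn x z : Set (BondConfig V))ᶜ) ωs *
      ind (openConn x y ∩ openConn x z : Set (BondConfig V)) ωs = 0 := by
    by_cases hC : ωs ∈ (openConn x y ∩ openConn x z : Set (BondConfig V))
    · have hN : ωs ∉ ((openConn x y : Set (BondConfig V))ᶜ ∩ (openConn x z : Set (BondConfig V))ᶜ) := fun h => h.1 hC.1
      rw [ind_of_not_mem hN, zero_mul]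
    · rw [ind_of_not_mem hC, mul_zero]
  have hBB : ind (openConn x y ∩ (openConn x z : Set (BondConfig V))ᶜ) ωs *
      ind ((openConn x y : Set (BondConfig V))ᶜ ∩ openConn x z) ωs = 0 := by
    by_cases hB : ωs ∈ (openConn x y ∩ (openConn x z : Set (BondConfig V))ᶜ : Set (BondConfig V))
    · have hB' : ωs ∉ ((openConn x y : Set (BondConfig V))ᶜ ∩ openConn x z) := fun h => h.1 hB.1
      rw [ind_of_not_mem hB', mul_zero]
    · rw [ind_of_not_mem hB, zero_mul]
  have hi : 0 ≤ ind ((openConn x y : Set (BondConfig V))ᶜ ∩ openConn y z) ωs := ind_nonneg _ _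
  have key : W * ind ((openConn x y : Set (BondConfig V))ᶜ ∩ (openConn x z : Set (BondConfig V))ᶜ) ωs *
        (W * ind (openConn x y ∩ openConn x z : Set (BondConfig V)) ωs) -
      W * ind (openConn x y ∩ (openConn x z : Set (BondConfig V))ᶜ) ωs *
        (W * ind ((openConn x y : Set (BondConfig V))ᶜ ∩ openConn x z) ωs) = 0 := by
    have e1 : W * ind ((openConn x y : Set (BondConfig V))ᶜ ∩ (openConn x z : Set (BondConfig V))ᶜ) ωs *
        (W * ind (openConn x y ∩ openConn x z : Set (BondConfig V)) ωs) =
        W * W * (ind ((openConn x y : Set (BondConfig V))ᶜ ∩ (openConn x z : Set (BondConfig V))ᶜ) ωs *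
          ind (openConn x y ∩ openConn x z : Set (BondConfig V)) ωs) := by ring
    have e2 : W * ind (openConn x y ∩ (openConn x z : Set (BondConfig V))ᶜ) ωs *
        (W * ind ((openConn x y : Set (BondConfig V))ᶜ ∩ openConn x z) ωs) =
        W * W * (ind (openConn x y ∩ (openConn x z : Set (BondConfig V))ᶜ) ωs *
          ind ((openConn x y : Set (BondConfig V))ᶜ ∩ openConn x z) ωs) := by ring
    rw [e1, e2, hNC, hBB]; ring
  rw [key, mul_zero, sub_zero]
  exact mul_nonneg (mul_nonneg hW hi) hZ

/-! ### The induction on undecided pairs -/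

/-- Deciding the pair `g` (parameter `0` or `1`) removes it from the set of undecided pairs. [folklore] -/
theorem undecided_update (w : Sym2 V → unitInterval) (g : Sym2 V) (c : unitInterval) (hc : (c : ℝ) = 0 ∨ (c : ℝ) = 1) :
    (Finset.univ.filter fun e : Sym2 V => 0 < ((Function.update w g c e : unitInterval) : ℝ) ∧
        ((Function.update w g c e : unitInterval) : ℝ) < 1) =
      (Finset.univ.filter fun e : Sym2 V => 0 < ((w e : unitInterval) : ℝ) ∧ ((w e : unitInterval) : ℝ) < 1).erase g := by
  ext e
  simp only [Finset.mem_filter, Finset.mem_univ, true_and, Finset.mem_erase]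
  by_cases he : e = g
  · subst he
    rw [Function.update_self]
    constructor
    · rintro ⟨h0, h1⟩
      exfalso
      rcases hc with h | h
      · rw [h] at h0; exact lt_irrefl _ h0
      · rw [h] at h1; exact lt_irrefl _ h1
    · rintro ⟨h, -⟩; exact absurd rfl h
  · rw [Function.update_of_ne he]
    simp [he]

/-- **`POL ⇒ HubCovBound` — the induction on undecided pairs (mass form).**  If the polarised bound holds for every pair
`(φ_{v[g↦0]}, φ_{v[g↦1]})` (all weight vectors `v` on `V`, all pairs `g`), then the three-point expression of every weight vector is
nonnegative. [cite: Grimmett2006, Thm. (3.1)(a) (p. 37); §3.9 eq. (3.94) (p. 63)] -/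
theorem threePointN_nonneg_of_pol {q : ℝ} (hq0 : 0 < q) (x y z : V)
    (hPOL : ∀ (v : Sym2 V → unitInterval) (g : Sym2 V),
      PolHubCovUnder (rcMeasureW (Function.update v g 0) q ∅) (rcMeasureW (Function.update v g 1) q ∅) q x y z) :
    ∀ (n : ℕ) (w : Sym2 V → unitInterval),
      (Finset.univ.filter fun e : Sym2 V => 0 < ((w e : unitInterval) : ℝ) ∧ ((w e : unitInterval) : ℝ) < 1).card = n →
      0 ≤ (∑ ω : BondConfig V, rcWeightW w q ∅ ω * ind ((openConn x y : Set (BondConfig V))ᶜ ∩ openConn y z) ω) *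
            rcPartitionFunctionW w q ∅ -
          (1 - q) *
            ((∑ ω : BondConfig V, rcWeightW w q ∅ ω *
                ind ((openConn x y : Set (BondConfig V))ᶜ ∩ (openConn x z : Set (BondConfig V))ᶜ) ω) *
              (∑ ω : BondConfig V, rcWeightW w q ∅ ω * ind (openConn x y ∩ openConn x z) ω) -
             (∑ ω : BondConfig V, rcWeightW w q ∅ ω * ind (openConn x y ∩ (openConn x z : Set (BondConfig V))ᶜ) ω) *
              (∑ ω : BondConfig V, rcWeightW w q ∅ ω * ind ((openConn x y : Set (BondConfig V))ᶜ ∩ openConn x z) ω)) := by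
  intro n
  induction n with
  | zero =>
    intro w hcard
    refine threePointN_nonneg_of_decided w hq0 (fun e => ?_) x y z
    have he : e ∉ (Finset.univ.filter fun e : Sym2 V => 0 < ((w e : unitInterval) : ℝ) ∧ ((w e : unitInterval) : ℝ) < 1) := by
      rw [Finset.card_eq_zero.1 hcard]; exact Finset.notMem_empty e
    simp only [Finset.mem_filter, Finset.mem_univ, true_and, not_and, not_lt] at he
    have h0 : 0 ≤ (w e : ℝ) := (w e).2.1
    have h1 : (w e : ℝ) ≤ 1 := (w e).2.2
    rcases h0.lt_or_eq with hpos | hzero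
    · exact Or.inr (le_antisymm h1 (he hpos))
    · exact Or.inl hzero.symm
  | succ n ih =>
    intro w hcard
    obtain ⟨g, hg⟩ : (Finset.univ.filter fun e : Sym2 V => 0 < ((w e : unitInterval) : ℝ) ∧ ((w e : unitInterval) : ℝ) < 1).Nonempty := by
      rw [← Finset.card_pos, hcard]; exact Nat.succ_pos n
    have h0card : (Finset.univ.filter fun e : Sym2 V => 0 < ((Function.update w g 0 e : unitInterval) : ℝ) ∧
        ((Function.update w g 0 e : unitInterval) : ℝ) < 1).card = n := by
      rw [undecided_update w g 0 (Or.inl rfl), Finset.card_erase_of_mem hg, hcard]; rfl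
    have h1card : (Finset.univ.filter fun e : Sym2 V => 0 < ((Function.update w g 1 e : unitInterval) : ℝ) ∧
        ((Function.update w g 1 e : unitInterval) : ℝ) < 1).card = n := by
      rw [undecided_update w g 1 (Or.inr rfl), Finset.card_erase_of_mem hg, hcard]; rfl
    have hT0 := ih (Function.update w g 0) h0card
    have hT1 := ih (Function.update w g 1) h1card
    have hB := (polHubCovUnder_iff_masses hq0 (Function.update w g 0) (Function.update w g 1) x y z).1 (hPOL w g)
    have hp0 : 0 ≤ (w g : ℝ) := (w g).2.1
    have hp1 : (w g : ℝ) ≤ 1 := (w g).2.2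
    rw [threePoint_affine_expand w q g x y z]
    have t1 := mul_nonneg (sq_nonneg (1 - (w g : ℝ))) hT0
    have t2 := mul_nonneg (sq_nonneg (w g : ℝ)) hT1
    have t3 := mul_nonneg (mul_nonneg hp0 (sub_nonneg.2 hp1)) hB
    linarith

/-- **`POL ⇒ HubCovBound`.**  If the polarised hub covariance bound holds between `φ_{v[g↦0]}` and `φ_{v[g↦1]}` for every weight vector
`v` on `V` and every pair `g` (at the hub `x` and the pair `y, z`), then the hub covariance bound holds for EVERY weight vector on `V` at
`(x; y, z)`; in particular the corresponding statement for all `V = Fin n`, `0 < q < 1`, would prove `HubCovBoundFKLtOne` and hence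
negative correlation of adjacent edges for every `q < 1`.  (Induction on the number of pairs with parameter in `(0,1)` via the exact
affine expansion `TP_w = (1−p)²TP⁰ + p²TP¹ + 2p(1−p)·B(M⁰, M¹)`; base: point mass.) [cite: Grimmett2006, §3.9 eq. (3.94) (p. 63)]
[cite: Wagner2006, Conj. 5.3 (p. 13)] -/
theorem hubCovBoundUnder_of_pol {q : ℝ} (hq0 : 0 < q) (x y z : V)
    (hPOL : ∀ (v : Sym2 V → unitInterval) (g : Sym2 V),
      PolHubCovUnder (rcMeasureW (Function.update v g 0) q ∅) (rcMeasureW (Function.update v g 1) q ∅) q x y z)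
    (w : Sym2 V → unitInterval) : HubCovBoundUnder (rcMeasureW w q ∅) q x y z := by
  rw [hubCovBoundUnder_iff_threePointN hq0]
  exact threePointN_nonneg_of_pol hq0 x y z hPOL _ w rfl

/-- The polarised bound is implied by nothing weaker that we know, but it is at least CONSISTENT at the diagonal: for a decided pair
(`w g ∈ {0,1}`) the two measures `φ_{w[g↦0]}, φ_{w[g↦1]}` include `φ_w` itself, and `PolHubCovUnder φ_w φ_w` is the hub covariance bound.
[folklore] -/
theorem polHubCovUnder_self_of_hubCovBound {q : ℝ} (hq0 : 0 < q) (w : Sym2 V → unitInterval) (x y z : V)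
    (h : HubCovBoundUnder (rcMeasureW w q ∅) q x y z) : PolHubCovUnder (rcMeasureW w q ∅) (rcMeasureW w q ∅) q x y z := by
  haveI := isProbabilityMeasure_rcMeasureW w hq0 (∅ : Set V)
  exact (polHubCovUnder_self_iff _ q x y z).2 h

end FK

end Summit.CriticalPhenomena.PercolationContinuityZ3.Theorems

end
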